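import Literature.IUT.LogThetaLattice.LatticeGlue
import Literature.IUT.LogThetaLattice.UnitMuCoricOfThetaMonoids
import Literature.IUT.HodgeArakelov.TemperedThetaMonoidsProofs
import Literature.IUT.HodgeArakelov.GoodPrimeFrobenioidMonoidsProofs
import Literature.AnabelianGeometry.AbsoluteAnabelian.MonoidKummerMapsProofs
import HarnessLib

/-!
# [IUTchIII] Proposition 2.1 (ii)–(vi): Kummer theory of theta monoids — proof-only companion

Mochizuki, *Inter-universal Teichmüller Theory III*, kurims manuscript (May 2020), §2, Proposition 2.1
(ii)–(vi), pp. 59–61, read on the page (lit key `paper:url-4b091feeb646`, pp. 58–61)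
[claim: Mochizuki2012, status: disputed] (D-0012 claim key). Printed proof (p. 61): "The various
assertions of Proposition 2.1 follow immediately from the definitions and the references quoted in the
statements of these assertions." DISCHARGE-L6 §F-b row F13-a (abc-iut cell, wave 4, D-0067 cone interior;
SUBDAG `plan/L6/SUBDAG-IUTchIII-Prop-21.md` rows r11–r27). PROOF-ONLY companion of abc-iut-L6-t3's
`ThetaMonoids.lean` (interface `ThetaMonoidData`, p405523): no definition, no new `Prop`; every theorem
below is a JUNCTION between the typed statement of the item and the typed decls of the references the
print quotes, with the FQ names of both sides in its docstring.

What the kernel is made to say, item by item.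

* (ii) "functorial algorithms … for constructing Kummer isomorphisms `Ψ_{F_env}(†HT^Θ) ⥲ Ψ_env(†D_>)`,
  `_∞Ψ_{F_env} ⥲ _∞Ψ_env`, `C^⊩_env(†HT^Θ) ⥲ D^⊩_env(†D^⊢_>)` … `†F^⊩_env ⥲ F^⊩_env(†D_>)`" — the isomorphisms
  are FIELDS of `ThetaMonoidData` (`kummerΨ`, `kummerΨInf`, `kummerC`, `kummerFgl`); "functorial" = natural
  in `†HT`: `kummerΨInf_naturality`, `kummerC_naturality`, `kummerFgl_naturality` (the `Ψ` square is
  t3's `ThetaMonoidData.kummerΨ_naturality`).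
* (ii)+(iii) at `v ∈ V^bad`: "the portion at `v ∈ V^bad` of the Kummer isomorphisms of (ii) is obtained
  by composing the Kummer isomorphisms of [IUTchII], Proposition 3.3, (i) … with the isomorphisms on
  cohomology classes induced … by the full poly-isomorphism of projective systems of mono-theta
  environments `M^Θ_*(†D_{>,v}) ⥲ M^Θ_*(†F_v)`" — over abc-iut-L6-t2's REAL theta monoids
  (`TemperedThetaMonoids.ThetaEnvData.thetaMonoid`, `.inftyThetaMonoid`,
  `TemperedFrobenioidThetaData.frobThetaMonoid`) and its Prop 3.3 (i) Kummer data
  (`TemperedThetaMonoids.Prop33KummerStatements.kummerTheta`): an isomorphism of ambient cohomology modules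
  carrying `M^×_TM` onto `M^×_TM` and `θ^ι_env` onto `θ^{ι'}_env` carries `Ψ^ι_env` ONTO `Ψ^{ι'}_env`
  (`thetaMonoid_map_equiv`, `inftyThetaMonoid_map_equiv`), so the composite
  `Ψ_{†F^Θ_v,α} ⥲ Ψ^ι_env(M^Θ_*(†F_v)) ⥲ Ψ^{ι'}_env(M^Θ_*(†D_{>,v}))` EXISTS and is UNIQUELY pinned by its values
  (`exists_kummer_comp_transport`, `kummer_comp_transport_unique`).
* (iii), last sentence: "the composite map `Π_μ(M^Θ_*(†D_{>,v})) ⊗ ℚ/ℤ → (Ψ_{†F^Θ_v})^{×μ}` … is equal to the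
  zero map" — at the REAL Frobenioid-theoretic theta monoid `Ψ_{†F^Θ_v,α}` ([IUTchII] Ex 3.2 (i)): every
  homomorphism from a torsion group into `(Ψ_{†F^Θ_v,α})^×` dies in `(Ψ_{†F^Θ_v,α})^{×μ}`
  (`frobThetaMonoid_torsion_comp_eq_one`, instance of t3's `torsion_comp_mkTorsionQuotient`), and every
  torsion element of the ambient module lying in `Ψ_{†F^Θ_v,α}` ("the natural inclusion
  `Π_μ(M^Θ_*(†F_v)) ⊗ ℚ/ℤ ↪ (Ψ_{†F^Θ_v})^×`", [IUTchII] Prop 1.3 (i)) is a unit of `Ψ_{†F^Θ_v,α}` whose class in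
  `(Ψ_{†F^Θ_v,α})^{×μ}` is trivial (`torsion_mem_frobThetaMonoid_timesMu_eq_one`).
* (iv)/(v): "the `Aut_{F^⊩}(†F^⊩_env)`-orbit of the second isomorphism of the final display of (ii)" IS the
  full poly-isomorphism `†F^⊩_env ⥲ F^⊩_env(†D_>)` (`autOrbit_kummerFglAt_eq_full`, pure category theory),
  and the induced poly-isomorphism of associated `F^{⊢×μ}`-prime-strips is the full one
  (`autOrbit_kummerFgl_fxm_eq_full`, via abc-iut-L6-d1's `map_full_fglxmToFxm` = [IUTchIII] Thm 2.2 (i));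
  the REALIFIED portion of the "Kummer poly-isomorphism of semi-simplifications" of [IUTchII] Prop 4.2
  (ii) / 4.4 (ii) is a SINGLE isomorphism: a pointed half-line has no non-trivial automorphism and two
  pointed half-lines have exactly one isomorphism (`PointedHalfLine.addEquiv_eq_refl_of_apply_pt`,
  `PointedHalfLine.addEquiv_eq_of_apply_pt`, from abc-iut-L6-t2/t5's `PointedHalfLine.isoUnique_holds`).
  UNIQUENESS of the labeled unit portion at `v ∈ V^good ∩ V^non` ("labeled version of the isomorphism of
  MLF-Galois `TM`-pairs of [IUTchII] Prop 4.2 (i) [cf. [AbsTopIII], Proposition 3.2, (iv)]"): label by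
  label, an isomorphism of MLF-Galois `TM`-pairs is determined by its Galois component
  (`labeled_pairIso_isoM_eq_of_isoPi_eq`, from abc-iut-L6-d7's PROVED [AbsTopIII] Prop 3.2 (iv)
  injectivity `pairIsoDeterminedByGalois_holds`). The EXISTENCE of the unit portions ([IUTchII] Prop 4.2
  (i)/(iv), 4.4 (i)/(iv)) is carried by SLOT-ONLY fields of abc-iut-L6-t2's
  `Prop42Statements`/`Prop44Statements` (bare `Prop`s) — nothing to inhabit; reported as SLOT, not
  discharged here.
* (vi): the natural isomorphism `F^{⊢×}_△(†D^⊢_△) ⥲ F^{⊢×}_env(†D_>)` on associated `F^{⊢×μ}`-prime-strips is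
  abc-iut-L6-t3's `ThetaMonoidData.unitPortionD` / `LatticeGlue.envNat`; "compatible with … Theorem 1.5,
  (iii)": naturality along every isomorphism of `D`-Hodge theaters, i.e. along every constituent of the
  VERTICAL poly-isomorphism of `BiCoricData.verticalPolyIso` (`envNat_conj_vertical`,
  `envNat_conj_mem_of_mem_verticalPolyIso`). The compatibility "with the Kummer isomorphisms of (ii)"
  (equality of the Frobenius-like route `†F^{⊢×μ}_△ ⥲ †F^{⊢×μ}_env ⥲ F^{⊢×μ}_env(†D_>)` with the étale-like route
  through `F^{⊢×μ}_△(†D^⊢_△)`) is a coherence law between `ThetaLinkData.unitPortion`, `BiCoricData.kummer`,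
  `ThetaMonoidData.kummerFgl` and `unitPortionD` that the interfaces `LatticeGlue` do NOT carry: recorded
  here in prose as the untyped junction «Prop21vi_kummerCompat» for the glue's successor file (owner
  abc-iut-L6-t3), NOT asserted and NOT smuggled in as a hypothesis.

Honest scope: interface-level bookkeeping plus elementary monoid/torsion/category lemmas; nothing here
bears on the disputed [IUTchIII] Cor. 3.12 or takes a side; typed ≠ discharged elsewhere.
-/

namespace Literature.IUT.LogThetaLattice

open CategoryTheory
open Literature.IUT.HodgeTheaters
open Literature.IUT.HodgeArakelov
open Literature.IUT.HodgeArakelov.TemperedThetaMonoids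

universe u v w

/-! ### Prop 2.1 (ii): the Kummer isomorphisms are functorial in the Hodge theater -/

namespace ThetaMonoidData

variable {S : StripFrame.{u}} (T : ThetaMonoidData S)

/-- **IUTchIII:Prop2.1(ii)** (kurims p.59) "functorial algorithms in the `Θ^{±ell}NF`-Hodge theater `†HT` for
constructing Kummer isomorphisms … `_∞Ψ_{F_env}(†HT^Θ) ⥲ _∞Ψ_env(†D_>)`": naturality of the field
`ThetaMonoidData.kummerΨInf` along a morphism `ξ : †HT → ‡HT` (the `_∞`-companion of t3's
`ThetaMonoidData.kummerΨ_naturality`). [claim: Mochizuki2012, status: disputed] -/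
theorem kummerΨInf_naturality {X Y : S.HT} (ξ : X ⟶ Y) :
    T.ΨFenvInf.map ξ ≫ (T.kummerΨInf.app Y).hom =
      (T.kummerΨInf.app X).hom ≫ T.ΨenvInfD.map (T.Dgt.map (S.htToD.map ξ)) :=
  T.kummerΨInf.hom.naturality ξ

/-- **IUTchIII:Prop2.1(ii)** (kurims p.59) "Kummer isomorphisms … `C^⊩_env(†HT^Θ) ⥲ D^⊩_env(†D^⊢_>)` — where the
final isomorphism of Frobenioids is compatible with the respective bijections involving `Prime(−)`, as
well as with the respective local isomorphisms" (compatibility with `Prime(−) ⥲ V̲` and the `ρ_v` is built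
into the morphisms of the target category `ThetaMonoidData.RF`, [IUTchII] Cor 4.5 (v)): naturality of
`ThetaMonoidData.kummerC` (`kummerCAt`) in `†HT`. [claim: Mochizuki2012, status: disputed] -/
theorem kummerC_naturality {X Y : S.HT} (ξ : X ⟶ Y) :
    T.CglEnv.map ξ ≫ (T.kummerCAt Y).hom =
      (T.kummerCAt X).hom ≫ T.DglEnv.map (S.DToDv.map (T.Dgt.map (S.htToD.map ξ))) :=
  T.kummerC.hom.naturality ξ

/-- **IUTchIII:Prop2.1(ii)** (kurims p.59) "the first and third Kummer isomorphisms … may be interpreted as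
[compatible] isomorphisms `†F^⊢_env ⥲ F^⊢_env(†D_>)`; `†F^⊩_env ⥲ F^⊩_env(†D_>)` of `F^⊢`-, `F^⊩`-prime-strips":
naturality of the `F^⊩`-prime-strip Kummer isomorphism `ThetaMonoidData.kummerFglAt` in `†HT`
([IUTchII] Cor 4.10 (ii) `†F^⊩_env`, input side `HodgeTheaterStrips.env` per SUBDAG r14).
[claim: Mochizuki2012, status: disputed] -/
theorem kummerFgl_naturality {X Y : S.HT} (ξ : X ⟶ Y) :
    T.FglEnvHT.map ξ ≫ (T.kummerFglAt Y).hom =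
      (T.kummerFglAt X).hom ≫ T.FglEnvD.map (T.Dgt.map (S.htToD.map ξ)) :=
  T.kummerFgl.hom.naturality ξ

/-- **IUTchIII:Prop2.1(ii)** (kurims p.59) the `F^⊩`-strip Kummer isomorphism TRANSPORTS isomorphisms of Hodge
theaters: for `ξ : †HT ≅ ‡HT`, conjugating `†F^⊩_env ⥲ ‡F^⊩_env` by the Kummer isomorphisms gives the étale-like
`F^⊩_env(†D_>) ⥲ F^⊩_env(‡D_>)` induced by `D_>(ξ)` ("[compatible] isomorphisms of `F^⊩`-prime-strips").
[claim: Mochizuki2012, status: disputed] -/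
theorem kummerFglAt_conj {X Y : S.HT} (ξ : X ≅ Y) :
    (T.kummerFglAt X).symm ≪≫ T.FglEnvHT.mapIso ξ ≪≫ T.kummerFglAt Y =
      T.FglEnvD.mapIso (T.Dgt.mapIso (S.htToD.mapIso ξ)) := by
  ext
  simp only [Iso.trans_hom, Iso.symm_hom, Functor.mapIso_hom]
  exact (Iso.inv_comp_eq (T.kummerFglAt X)).mpr (T.kummerFgl.hom.naturality ξ.hom)

/-! ### Prop 2.1 (iv)/(v): the `Aut_{F^⊩}(†F^⊩_env)`-orbit of `†F^⊩_env ⥲ F^⊩_env(†D_>)` -/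

/-- **IUTchIII:Prop2.1(iv)** (kurims p.60) "the `Aut_{F^⊩}(†F^⊩_env)`-orbit of the second isomorphism of the
final display of (ii)", i.e. `{α ≫ κ | α ∈ Aut_{F^⊩}(†F^⊩_env)}` with `κ : †F^⊩_env ⥲ F^⊩_env(†D_>)` the Kummer
isomorphism `ThetaMonoidData.kummerFglAt`, IS the full poly-isomorphism `†F^⊩_env ⥲ F^⊩_env(†D_>)` of
[IUTchI] §0 (every isomorphism `f` is `(f ≫ κ⁻¹) ≫ κ`). [claim: Mochizuki2012, status: disputed] -/
theorem autOrbit_kummerFglAt_eq_full (X : S.HT) :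
    (PolyIso.full (T.FglEnvHT.obj X) (T.FglEnvHT.obj X)).comp (PolyIso.single (T.kummerFglAt X)) =
      PolyIso.full (T.FglEnvHT.obj X) (T.FglEnvD.obj (T.Dgt.obj (S.htToD.obj X))) :=
  PolyIso.full_comp_of_nonempty ⟨T.kummerFglAt X, PolyIso.mem_single.mpr rfl⟩

/-- **IUTchIII:Prop2.1(iv)** (kurims p.60) / **IUTchIII:Prop2.1(v)** (kurims p.60) the orbit read on the associated
`F^{⊩▶×μ}`-prime-strips ([IUTchII] Def 4.9 (viii), the frame's `FglToFglxm`): the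
`Aut_{F^{⊩▶×μ}}`-orbit of the induced Kummer isomorphism is again the full poly-isomorphism.
[claim: Mochizuki2012, status: disputed] -/
theorem autOrbit_kummerFglxm_eq_full (X : S.HT) :
    (PolyIso.full (S.FglToFglxm.obj (T.FglEnvHT.obj X)) (S.FglToFglxm.obj (T.FglEnvHT.obj X))).comp
        (PolyIso.single (S.FglToFglxm.mapIso (T.kummerFglAt X))) =
      PolyIso.full (S.FglToFglxm.obj (T.FglEnvHT.obj X))
        (S.FglToFglxm.obj (T.FglEnvD.obj (T.Dgt.obj (S.htToD.obj X)))) :=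
  PolyIso.full_comp_of_nonempty ⟨_, PolyIso.mem_single.mpr rfl⟩

/-- **IUTchIII:Prop2.1(iv)** (kurims p.60) "the portion … of the `Aut_{F^⊩}(†F^⊩_env)`-orbit … may be obtained as
a «labeled version» of the «Kummer poly-isomorphism of semi-simplifications» given in the final display of
[IUTchII], Proposition 4.2, (ii)" — at the level of the associated `F^{⊢×μ}`-prime-strips the kernel
statement available over the frame is: the poly-isomorphism of `F^{⊢×μ}`-prime-strips
`(†F^{⊩▶×μ}_env)^{⊢×μ} ⥲ (F^{⊩▶×μ}_env(†D_>))^{⊢×μ}` induced by the `Aut_{F^{⊩▶×μ}}`-orbit is the FULL poly-isomorphism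
(abc-iut-L6-d1's `map_full_fglxmToFxm`, i.e. [IUTchIII] Thm 2.2 (i) `ThetaMonoidData.mapAut_surjective`).
The finer printed content — that the unit portion at `v` is the `Ism`-orbit (resp. `Ẑ^×`-orbit) of [IUTchII] Prop 4.2
(ii) and the realified portion a single isomorphism — lives below the frame: see
`PointedHalfLine.addEquiv_eq_of_apply_pt` for the realified half; the unit half is the SLOT field
`Prop42Statements.unitOrbit` (abc-iut-L6-t2), not inhabited here. [claim: Mochizuki2012, status: disputed] -/
theorem autOrbit_kummerFgl_fxm_eq_full (X : S.HT) :
    ((PolyIso.full (S.FglToFglxm.obj (T.FglEnvHT.obj X)) (S.FglToFglxm.obj (T.FglEnvHT.obj X))).comp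
        (PolyIso.single (S.FglToFglxm.mapIso (T.kummerFglAt X)))).map S.FglxmToFxm =
      PolyIso.full (S.FglxmToFxm.obj (S.FglToFglxm.obj (T.FglEnvHT.obj X)))
        (S.FglxmToFxm.obj (S.FglToFglxm.obj (T.FglEnvD.obj (T.Dgt.obj (S.htToD.obj X))))) := by
  rw [autOrbit_kummerFglxm_eq_full, map_full_fglxmToFxm T]

end ThetaMonoidData

/-! ### Prop 2.1 (iv)/(v): the realified portion of the Kummer poly-isomorphism of semi-simplifications
is a single isomorphism ([IUTchII] Prop 4.2 (ii) / 4.4 (ii), `PointedHalfLine`) -/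

/-- **IUTchIII:Prop2.1(iv)** (kurims p.60) realified half of the "Kummer poly-isomorphism of
semi-simplifications" of [IUTchII] Prop 4.2 (ii) p.124 ("a unique isomorphism of monoids
`Ψ^R_{†F^⊢_v} ⥲ Ψ^R_cns(†G_v)` that maps the distinguished element … to the distinguished element"): over
abc-iut-L6-t2's `PointedHalfLine` (the tree's `Ψ^R` with its distinguished element), two isomorphisms of the
underlying monoid `ℝ_{≥0}` that both carry the distinguished element of `A` to that of `B` COINCIDE — the
realified portion of the `Aut`-orbit of Prop 2.1 (iv) is one isomorphism (from `PointedHalfLine.isoUnique_holds`,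
abc-iut-L6-t5). [claim: Mochizuki2012, status: disputed] -/
theorem _root_.Literature.IUT.HodgeArakelov.PointedHalfLine.addEquiv_eq_of_apply_pt (A B : PointedHalfLine)
    (e e' : NNReal ≃+ NNReal) (he : e A.pt = B.pt) (he' : e' A.pt = B.pt) : e = e' :=
  (PointedHalfLine.isoUnique_holds A B e he).trans (PointedHalfLine.isoUnique_holds A B e' he').symm

/-- **IUTchIII:Prop2.1(v)** (kurims p.60) the same rigidity read as "no automorphisms": an automorphism of the
realified monoid `Ψ^R ≅ ℝ_{≥0}` fixing the distinguished element (`log(p_v)`, resp. the element determined by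
`p_v = e` at `v ∈ V^arc`, [IUTchII] Prop 4.4 (ii) p.130) is the identity — so the `Aut_{F^⊩}(†F^⊩_env)`-orbit
of Prop 2.1 (iv)/(v) moves the realified portion not at all. [claim: Mochizuki2012, status: disputed] -/
theorem _root_.Literature.IUT.HodgeArakelov.PointedHalfLine.addEquiv_eq_refl_of_apply_pt (A : PointedHalfLine)
    (e : NNReal ≃+ NNReal) (he : e A.pt = A.pt) : e = AddEquiv.refl NNReal :=
  PointedHalfLine.addEquiv_eq_of_apply_pt A A e (AddEquiv.refl NNReal) he rfl

/-! ### Prop 2.1 (iv): the labeled unit-portion Kummer isomorphism is determined by its Galois part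
([AbsTopIII] Prop 3.2 (iv), PROVED in the tree) -/

/-- **IUTchIII:Prop2.1(iv)** (kurims p.60) "the unit portion at `v ∈ V^good ∩ V^non` of the Kummer
isomorphisms of (ii) is obtained … as the unit portion of a «labeled version» of the isomorphism … of
«MLF-Galois TM-pairs» … discussed in [IUTchII], Proposition 4.2, (i) [cf. also … [AbsTopIII], Proposition
3.2, (iv)]": for a family of MLF-Galois `TM`-pairs indexed by labels `t ∈ LabCusp^±` (abc-iut-L4-t2's
`GaloisMonoidPair`, `IsMLFGaloisMonoidPair .TM`), two label-wise isomorphisms of pairs with the same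
Galois components have the same monoid components — the labeled Kummer isomorphism is UNIQUE over its
Galois part (label-wise instance of abc-iut-L6-d7's PROVED `pairIsoDeterminedByGalois_holds`,
[AbsTopIII] Prop 3.2 (iv) injectivity). [claim: Mochizuki2012, status: disputed] -/
theorem labeled_pairIso_isoM_eq_of_isoPi_eq {Lab : Type w}
    (P Q : Lab → Literature.AnabelianGeometry.AbsoluteAnabelian.GaloisMonoidPair.{0})
    (hP : ∀ t, Literature.AnabelianGeometry.AbsoluteAnabelian.IsMLFGaloisMonoidPair .TM (P t))
    (hQ : ∀ t, Literature.AnabelianGeometry.AbsoluteAnabelian.IsMLFGaloisMonoidPair .TM (Q t))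
    (e₁ e₂ : ∀ t, Literature.AnabelianGeometry.AbsoluteAnabelian.GaloisMonoidPair.Iso (P t) (Q t))
    (h : ∀ t, (e₁ t).isoPi = (e₂ t).isoPi) (t : Lab) : (e₁ t).isoM = (e₂ t).isoM :=
  Literature.AnabelianGeometry.AbsoluteAnabelian.pairIsoDeterminedByGalois_holds (P t) (Q t) (hP t) (hQ t)
    (e₁ t) (e₂ t) (h t)

/-! ### Prop 2.1 (ii)+(iii) at `v ∈ V^bad`: transport of the REAL theta monoids along an isomorphism of
mono-theta environments, and the composite Kummer isomorphism -/

section BadPrimes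

variable {P P' : Type u} [Group P] [Group P']
variable (E : ThetaEnvData.{u, v} P) (E' : ThetaEnvData.{u, v} P')

/-- **IUTchIII:Prop2.1(iii)** (kurims pp.59–60) "the isomorphisms on cohomology classes induced [cf. the
upper left-hand portion of the first display of [IUTchII], Proposition 3.4, (i)] by the full
poly-isomorphism of projective systems of mono-theta environments `M^Θ_*(†D_{>,v}) ⥲ M^Θ_*(†F_v)`": an
isomorphism `e` of the ambient cohomology modules of two mono-theta-environment data (abc-iut-L6-t2's
`TemperedThetaMonoids.ThetaEnvData`) that carries `M^×_TM` onto `M^×_TM` and the theta classes `θ^ι_env` onto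
`θ^{ι'}_env` carries the REAL theta monoid `Ψ^ι_env = M^×_TM·(θ^ι_env)^ℕ` ([IUTchII] Prop 3.1 (i),
`ThetaEnvData.thetaMonoid`) ONTO `Ψ^{ι'}_env`. [claim: Mochizuki2012, status: disputed] -/
theorem thetaMonoid_map_equiv (e : E.H ≃* E'.H) {ι : E.Iota} {ι' : E'.Iota}
    (hU : e '' (E.units : Set E.H) = E'.units) (hθ : e '' E.thetaEnv ι = E'.thetaEnv ι') :
    (E.thetaMonoid ι).map e.toMonoidHom = E'.thetaMonoid ι' := by
  have hU' : E.units.toSubmonoid.map e.toMonoidHom = E'.units.toSubmonoid :=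
    SetLike.coe_injective (by simpa using hU)
  unfold ThetaEnvData.thetaMonoid splitMonoid
  rw [Submonoid.map_sup, hU', MonoidHom.map_mclosure]
  congr 2

/-- **IUTchIII:Prop2.1(iii)** (kurims pp.59–60) the same transport for `_∞Ψ^ι_env = M^×_TM·(∞θ^ι_env)^ℕ`
(`ThetaEnvData.inftyThetaMonoid`). [claim: Mochizuki2012, status: disputed] -/
theorem inftyThetaMonoid_map_equiv (e : E.H ≃* E'.H) {ι : E.Iota} {ι' : E'.Iota}
    (hU : e '' (E.units : Set E.H) = E'.units) (hθ : e '' E.inftyThetaEnv ι = E'.inftyThetaEnv ι') :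
    (E.inftyThetaMonoid ι).map e.toMonoidHom = E'.inftyThetaMonoid ι' := by
  have hU' : E.units.toSubmonoid.map e.toMonoidHom = E'.units.toSubmonoid :=
    SetLike.coe_injective (by simpa using hU)
  unfold ThetaEnvData.inftyThetaMonoid splitMonoid
  rw [Submonoid.map_sup, hU', MonoidHom.map_mclosure]
  congr 2

variable {E E'}

/-- **IUTchIII:Prop2.1(ii)** (kurims p.59) / **IUTchIII:Prop2.1(iii)** (kurims pp.59–60) "the portion at
`v ∈ V^bad` of the Kummer isomorphisms of (ii) is obtained by composing the Kummer isomorphisms of [IUTchII],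
Proposition 3.3, (i) [`Ψ_{†F^Θ_v,α} ⥲ Ψ^ι_env(M^Θ_*(†F_v))`, abc-iut-L6-t2's DATA
`Prop33KummerStatements.kummerTheta`] … with the isomorphisms on cohomology classes induced … by [an
isomorphism] `M^Θ_*(†D_{>,v}) ⥲ M^Θ_*(†F_v)`": the composite
`Ψ_{†F^Θ_v,α} ⥲ Ψ^ι_env(M^Θ_*(†F_v)) ⥲ Ψ^{ι'}_env(M^Θ_*(†D_{>,v}))` EXISTS as an isomorphism of the REAL monoids whose
underlying map is "Kummer class, then transport by `e`" (existence of the functorial algorithm's output; the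
formula pins it down uniquely, `kummer_comp_transport_unique`). [claim: Mochizuki2012, status: disputed] -/
theorem exists_kummer_comp_transport {F : TemperedFrobenioidThetaData.{u, v} P}
    (K : Prop33KummerStatements E F) (e : E.H ≃* E'.H) (α : P) {ι' : E'.Iota}
    (hU : e '' (E.units : Set E.H) = E'.units) (hθ : e '' E.thetaEnv (K.label α) = E'.thetaEnv ι') :
    ∃ κ : F.frobThetaMonoid α ≃* E'.thetaMonoid ι',
      ∀ x : F.frobThetaMonoid α, ((κ x : E'.thetaMonoid ι') : E'.H) = e ((K.kummerTheta α x : _) : E.H) := by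
  refine ⟨(K.kummerTheta α).trans ((e.submonoidMap (E.thetaMonoid (K.label α))).trans
    (MulEquiv.submonoidCongr (thetaMonoid_map_equiv E E' e hU hθ))), fun x => ?_⟩
  rfl

/-- **IUTchIII:Prop2.1(ii)** (kurims p.59) uniqueness of that composite: an isomorphism of the REAL monoids is
determined by its underlying map into the ambient module (so "the" Kummer isomorphism of (ii) at `v ∈ V^bad`
is well defined once [IUTchII] Prop 3.3 (i)'s isomorphism and the transporting isomorphism are fixed).
[claim: Mochizuki2012, status: disputed] -/
theorem kummer_comp_transport_unique {F : TemperedFrobenioidThetaData.{u, v} P}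
    (K : Prop33KummerStatements E F) (e : E.H ≃* E'.H) (α : P) {ι' : E'.Iota}
    (κ κ' : F.frobThetaMonoid α ≃* E'.thetaMonoid ι')
    (hκ : ∀ x, ((κ x : E'.thetaMonoid ι') : E'.H) = e ((K.kummerTheta α x : _) : E.H))
    (hκ' : ∀ x, ((κ' x : E'.thetaMonoid ι') : E'.H) = e ((K.kummerTheta α x : _) : E.H)) : κ = κ' := by
  ext x
  exact (hκ x).trans (hκ' x).symm

/-- **IUTchIII:Prop2.1(ii)** (kurims p.59) the `_∞`-version at `v ∈ V^bad`: the composite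
`_∞Ψ_{†F^Θ_v,α} ⥲ _∞Ψ^ι_env(M^Θ_*(†F_v)) ⥲ _∞Ψ^{ι'}_env(M^Θ_*(†D_{>,v}))` exists (from
`Prop33KummerStatements.kummerInftyTheta` and `inftyThetaMonoid_map_equiv`).
[claim: Mochizuki2012, status: disputed] -/
theorem exists_kummerInfty_comp_transport {F : TemperedFrobenioidThetaData.{u, v} P}
    (K : Prop33KummerStatements E F) (e : E.H ≃* E'.H) (α : P) {ι' : E'.Iota}
    (hU : e '' (E.units : Set E.H) = E'.units)
    (hθ : e '' E.inftyThetaEnv (K.label α) = E'.inftyThetaEnv ι') :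
    ∃ κ : F.inftyFrobThetaMonoid α ≃* E'.inftyThetaMonoid ι',
      ∀ x : F.inftyFrobThetaMonoid α,
        ((κ x : E'.inftyThetaMonoid ι') : E'.H) = e ((K.kummerInftyTheta α x : _) : E.H) := by
  refine ⟨(K.kummerInftyTheta α).trans ((e.submonoidMap (E.inftyThetaMonoid (K.label α))).trans
    (MulEquiv.submonoidCongr (inftyThetaMonoid_map_equiv E E' e hU hθ))), fun x => ?_⟩
  rfl

/-- **IUTchIII:Prop2.1(ii)** (kurims p.59) the two composite Kummer isomorphisms (for `Ψ` and `_∞Ψ`) are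
COMPATIBLE with the inclusions `Ψ ⊆ _∞Ψ` on both sides, because [IUTchII] Prop 3.3 (i)'s are
(`Prop33KummerStatements.kummer_compatible`) and the transport is one map `e`.
[claim: Mochizuki2012, status: disputed] -/
theorem kummer_comp_transport_compatible {F : TemperedFrobenioidThetaData.{u, v} P}
    (K : Prop33KummerStatements E F) (e : E.H ≃* E'.H) (α : P) {ι' : E'.Iota}
    (κ : F.frobThetaMonoid α ≃* E'.thetaMonoid ι')
    (κinf : F.inftyFrobThetaMonoid α ≃* E'.inftyThetaMonoid ι')
    (hκ : ∀ x, ((κ x : E'.thetaMonoid ι') : E'.H) = e ((K.kummerTheta α x : _) : E.H))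
    (hκinf : ∀ x, ((κinf x : E'.inftyThetaMonoid ι') : E'.H) = e ((K.kummerInftyTheta α x : _) : E.H))
    (x : F.frobThetaMonoid α) :
    ((κinf ⟨x.1, F.frobThetaMonoid_le_infty α x.2⟩ : E'.inftyThetaMonoid ι') : E'.H) =
      ((κ x : E'.thetaMonoid ι') : E'.H) := by
  rw [hκ, hκinf, K.kummer_compatible]

/-! ### Prop 2.1 (iii), last sentence: the composite `Π_μ ⊗ ℚ/ℤ → (Ψ_{†F^Θ_v})^{×μ}` is the zero map -/

/-- **IUTchIII:Prop2.1(iii)** (kurims p.60) "the composite map `Π_μ(M^Θ_*(†D_{>,v})) ⊗ ℚ/ℤ → (Ψ_{†F^Θ_v})^{×μ}`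
obtained by composing … with the natural inclusion `Π_μ(M^Θ_*(†F_v)) ⊗ ℚ/ℤ ↪ (Ψ_{†F^Θ_v})^×` … and the natural
projection `(Ψ_{†F^Θ_v})^× ↠ (Ψ_{†F^Θ_v})^{×μ}` is equal to the zero map" — at the REAL Frobenioid-theoretic theta
monoid `Ψ_{†F^Θ_v,α} = O^×_{C^Θ_v}·(Θ^α_v)^ℕ` of [IUTchII] Ex 3.2 (i) (abc-iut-L6-t2's
`TemperedFrobenioidThetaData.frobThetaMonoid`): ANY homomorphism from a torsion group (such as
`Π_μ ⊗ ℚ/ℤ ≅ ℚ/ℤ`) into the unit group `(Ψ_{†F^Θ_v,α})^×`, followed by `(−)^× ↠ (−)^{×μ} = (−)^×/torsion`, is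
trivial — instance of abc-iut-L6-t3's mechanism `torsion_comp_mkTorsionQuotient`.
[claim: Mochizuki2012, status: disputed] -/
theorem frobThetaMonoid_torsion_comp_eq_one (F : TemperedFrobenioidThetaData.{u, v} P) (α : P)
    {Tor : Type w} [CommGroup Tor] (hT : Monoid.IsTorsion Tor) (f : Tor →* (F.frobThetaMonoid α)ˣ) :
    (QuotientGroup.mk' (CommGroup.torsion (F.frobThetaMonoid α)ˣ)).comp f = 1 :=
  torsion_comp_mkTorsionQuotient hT f

/-- **IUTchIII:Prop2.1(iii)** (kurims p.60) the "natural inclusion `Π_μ(M^Θ_*(†F_v)) ⊗ ℚ/ℤ ↪ (Ψ_{†F^Θ_v})^×`"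
([IUTchII] Prop 1.3 (i): the exterior cyclotome of a mono-theta environment arising from a tempered
Frobenioid is the cyclotome of roots of unity of the base field) read on the REAL monoid: a TORSION element
of the ambient module `O^×(T_{A^Θ_∞})` that lies in `Ψ_{†F^Θ_v,α}` is a unit of `Ψ_{†F^Θ_v,α}` (its inverse is a
power of itself), of finite order there, hence has trivial image in `(Ψ_{†F^Θ_v,α})^{×μ} = (−)^×/(−)^μ` — the
element-wise form of "is equal to the zero map". [claim: Mochizuki2012, status: disputed] -/
theorem torsion_mem_frobThetaMonoid_timesMu_eq_one (F : TemperedFrobenioidThetaData.{u, v} P) (α : P)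
    (x : F.frobThetaMonoid α) (hx : IsOfFinOrder (x : F.K)) :
    ∃ u : (F.frobThetaMonoid α)ˣ, (u : F.frobThetaMonoid α) = x ∧
      (QuotientGroup.mk u : (F.frobThetaMonoid α)ˣ ⧸ CommGroup.torsion (F.frobThetaMonoid α)ˣ) = 1 := by
  have hx' : IsOfFinOrder x := Submonoid.isOfFinOrder_coe.mp hx
  refine ⟨hx'.unit, hx'.val_unit, ?_⟩
  rw [QuotientGroup.eq_one_iff, CommGroup.mem_torsion, ← orderOf_pos_iff, ← orderOf_units, hx'.val_unit]
  exact hx'.orderOf_pos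

end BadPrimes

/-! ### Prop 2.1 (vi): the natural isomorphism `F^{⊢×}_△(†D^⊢_△) ⥲ F^{⊢×}_env(†D_>)` and Thm 1.5 (iii) -/

namespace LatticeGlue

variable {S : StripFrame.{u}} (G : LatticeGlue S)

/-- **IUTchIII:Prop2.1(vi)** (kurims pp.60–61) "natural isomorphisms … `F^{⊢×}_△(†D^⊢_△) ⥲ F^{⊢×}_env(†D_>)` … of
the respective associated `F^{⊢×}`-prime-strips [cf. the notation of Theorem 1.5, (iii)]" — on associated
`F^{⊢×μ}`-prime-strips this is `LatticeGlue.envNat` (= t3's `ThetaMonoidData.unitPortionD` transported to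
`BiCoricData`'s copy of `F^{⊢×μ}_△(†D^⊢_△)`); NATURAL = compatible with every morphism `ξ : †HT^D → ‡HT^D` of
`D`-Hodge theaters. [claim: Mochizuki2012, status: disputed] -/
theorem envNat_naturality {H H' : S.DHT} (ξ : H ⟶ H') :
    (G.biCoric.dvDelta ⋙ G.biCoric.fxmOfDv).map ξ ≫ G.envNat.hom.app H' =
      G.envNat.hom.app H ≫ G.fxmEnvD.map ξ :=
  G.envNat.hom.naturality ξ

/-- **IUTchIII:Prop2.1(vi)** (kurims p.61) "compatible with … Theorem 1.5, (iii)", vertical constituents: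
conjugating the isomorphism `F^{⊢×μ}_△(†D^⊢_△) ⥲ F^{⊢×μ}_△(‡D^⊢_△)` induced (through `†HT^D ↦ †D^⊢_△ ↦ F^{⊢×μ}_△(−)`) by
an isomorphism `ξ` of `D`-Hodge theaters by the natural isomorphisms of (vi) yields the isomorphism
`F^{⊢×μ}_env(†D_>) ⥲ F^{⊢×μ}_env(‡D_>)` induced by the same `ξ`. [claim: Mochizuki2012, status: disputed] -/
theorem envNat_conj_vertical {H H' : S.DHT} (ξ : H ≅ H') :
    (G.envNat.app H).symm ≪≫ G.biCoric.fxmOfDv.mapIso (G.biCoric.dvDelta.mapIso ξ) ≪≫ G.envNat.app H' =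
      G.fxmEnvD.mapIso ξ := by
  ext
  simp only [Iso.trans_hom, Iso.symm_hom, Functor.mapIso_hom, Iso.app_hom, Iso.app_inv]
  exact (Iso.inv_comp_eq (G.envNat.app H)).mpr (G.envNat.hom.naturality ξ.hom)

/-- **IUTchIII:Prop2.1(vi)** (kurims p.61) "compatible with … Theorem 1.5, (iii)", poly-isomorphism form:
every constituent of abc-iut-L6-t3's VERTICAL poly-isomorphism `BiCoricData.verticalPolyIso`
(`F^{⊢×μ}_△(^{n,m}D^⊢_△) ⥲ F^{⊢×μ}_△(^{n,m'}D^⊢_△)`, Thm 1.5 (iii) p.49), conjugated by the natural isomorphisms of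
(vi), is a constituent of the poly-isomorphism `F^{⊢×μ}_env(^{n,m}D_>) ⥲ F^{⊢×μ}_env(^{n,m'}D_>)` induced by the full
poly-isomorphism of `D`-Hodge theaters (Thm 1.5 (i)). [claim: Mochizuki2012, status: disputed] -/
theorem envNat_conj_mem_of_mem_verticalPolyIso {H H' : S.DHT}
    {f : G.biCoric.fxmDeltaOf H ≅ G.biCoric.fxmDeltaOf H'} (hf : f ∈ G.biCoric.verticalPolyIso H H') :
    (G.envNat.app H).symm ≪≫ f ≪≫ G.envNat.app H' ∈ (PolyIso.full H H').map G.fxmEnvD := by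
  obtain ⟨g, ⟨a, ha, b, ⟨ξ, -, rfl⟩, rfl⟩, c, hc, rfl⟩ := hf
  rw [PolyIso.mem_single] at ha hc
  subst ha; subst hc
  refine PolyIso.mem_map.mpr ⟨ξ, PolyIso.mem_full ξ, ?_⟩
  have hf : ((G.biCoric.deltaIso H).symm ≪≫
        G.biCoric.fxOfDsucc.mapIso ((S.dstrip G.biCoric.succ).mapIso ξ)) ≪≫ G.biCoric.deltaIso H' =
      G.biCoric.fxmOfDv.mapIso (G.biCoric.dvDelta.mapIso ξ) :=
    (Iso.trans_assoc _ _ _).trans (G.biCoric.mapIso_eq_conj ξ)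
  calc G.fxmEnvD.mapIso ξ
      = (G.envNat.app H).symm ≪≫ G.biCoric.fxmOfDv.mapIso (G.biCoric.dvDelta.mapIso ξ) ≪≫
          G.envNat.app H' := (G.envNat_conj_vertical ξ).symm
    _ = (G.envNat.app H).symm ≪≫ (((G.biCoric.deltaIso H).symm ≪≫
          G.biCoric.fxOfDsucc.mapIso ((S.dstrip G.biCoric.succ).mapIso ξ)) ≪≫ G.biCoric.deltaIso H') ≪≫
          G.envNat.app H' :=
        congrArg (fun t => (G.envNat.app H).symm ≪≫ t ≪≫ G.envNat.app H') hf.symm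

end LatticeGlue

end Literature.IUT.LogThetaLattice
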